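import Literature.Topology.FourManifolds.HomotopySpheresInverse
import Literature.Topology.FourManifolds.BallRemovalCobordism
import HarnessLib

/-!
# Inverses in `Θₙ`: the smooth half of Kervaire–Milnor's Lemma 2.3, discharged

Topic `Literature/Topology/FourManifolds`, sibling proofs file of `HomotopySpheresInverse.lean`.
That file decomposes Kervaire–Milnor's Lemma 2.3 (*Groups of homotopy spheres I*, Ann. of Math.
77 (1963), p. 506), direction `⇐` — *a closed simply connected manifold bounding a contractible
manifold is h-cobordant to `Sⁿ`* — into a smooth construction and a homotopy-theoretic
verification, both vendored there as named facts:

* `Literature.Topology.FourManifolds.NullCobordism.exists_cobordism_sphere_compl_ball` — "if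
  `M = bW'` …, then removing the interior of an imbedded disk we obtain a … manifold `W` with
  `bW = M + (-Sⁿ)`" (p. 506): for a null-cobordism `M = ∂W'` of a nonempty closed smooth
  `n`-manifold there are a smooth open disc `i : ℝⁿ⁺¹ → Int W'` and a cobordism `(W; M, 𝕊ⁿ)` with
  a homeomorphism `W ≅ W' ∖ i(B̊ⁿ⁺¹)` which is the boundary inclusion on `M` and `i` on `𝕊ⁿ`;
* `Literature.Topology.FourManifolds.NullCobordism.isHomotopyEquiv_compl_ball_of_contractibleSpace`
  — both ends of that cobordism are homotopy equivalences when `W'` is contractible (excision,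
  Poincaré duality, Whitehead).

The first of these is **proved** in the tree: `BallRemovalCobordism.lean` carries out the
construction (the complement of the open ball is assembled as a compact `C^∞` manifold with
boundary `∂W' ⊔ Sⁿ` by gluing `W' ∖ i(B̄)` to the collar `{½ < ‖b‖ ≤ 1}` of the closed unit ball
along the inversion `v ↦ v / ‖v‖²`) and proves the statement of the named fact verbatim as
`Literature.Topology.FourManifolds.NullCobordism.exists_cobordism_sphere_homeomorph_compl_ball`.
Neither of the two files imports the other, so the discharge
`NullCobordism.exists_cobordism_sphere_compl_ball_holds` is recorded here, together with the
resulting form of Lemma 2.3 (`⇐`) conditional only on its homotopy-theoretic half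
(`isHCobordant_sphere_of_boundsContractible_of_isHomotopyEquiv`).

## References

* M. Kervaire, J. Milnor, *Groups of homotopy spheres I*, Ann. of Math. (2) 77 (1963), 504–537:
  Lemma 2.3 and its proof (p. 506). doi:10.2307/1970128 [KervaireMilnorAnnals1963]
* J. Milnor, *Lectures on the h-cobordism theorem*, Princeton (1965), §1. [MilnorHCobordism1965]
-/

noncomputable section

namespace Literature.Topology.FourManifolds

/-- **The smooth half of Kervaire–Milnor's Lemma 2.3, discharged**: the named fact
`NullCobordism.exists_cobordism_sphere_compl_ball` holds — for every null-cobordism `M = ∂W'` of a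
nonempty closed smooth `n`-manifold `M`, removing an open ball `i(B̊ⁿ⁺¹)` from the interior of `W'`
leaves a cobordism `(W; M, 𝕊ⁿ)`, `W ≅ W' ∖ i(B̊ⁿ⁺¹)` restricting to the boundary inclusion on `M`
and to `i` on `𝕊ⁿ` (Kervaire–Milnor, *Groups of homotopy spheres I* (1963), proof of Lemma 2.3,
p. 506: "if `M = bW'` …, then removing the interior of an imbedded disk we obtain a … manifold
`W` with `bW = M + (-Sⁿ)`"; Milnor, *Lectures on the h-cobordism theorem* (1965), §1). The proof
is the tree theorem `NullCobordism.exists_cobordism_sphere_homeomorph_compl_ball`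
(`BallRemovalCobordism.lean`), whose statement is that of the fact.
[cite: KervaireMilnorAnnals1963, Lemma 2.3, proof (p. 506)] -/
theorem NullCobordism.exists_cobordism_sphere_compl_ball_holds :
    NullCobordism.exists_cobordism_sphere_compl_ball :=
  fun n M _ _ _ _ _ _ _ c => NullCobordism.exists_cobordism_sphere_homeomorph_compl_ball n M c

/-- **Kervaire–Milnor's Lemma 2.3 (`⇐`) from its homotopy-theoretic half alone.** GIVEN the
homotopy theory of the ball complement
(`NullCobordism.isHomotopyEquiv_compl_ball_of_contractibleSpace`: for `W'` contractible with
simply connected boundary, both ends of `(W' ∖ i(B̊ⁿ⁺¹); M, 𝕊ⁿ)` are homotopy equivalences), a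
closed simply connected smooth `n`-manifold, `n ≥ 2`, which bounds a contractible manifold is
h-cobordant to `𝕊ⁿ` — the smooth half of the printed proof being the theorem
`NullCobordism.exists_cobordism_sphere_compl_ball_holds` (Kervaire–Milnor 1963, proof of
Lemma 2.3, pp. 506–507; reduction `isHCobordant_sphere_of_boundsContractible_of` of
`HomotopySpheresInverse.lean`). [cite: KervaireMilnorAnnals1963, Lemma 2.3, proof (pp. 506–507)] -/
theorem isHCobordant_sphere_of_boundsContractible_of_isHomotopyEquiv
    (h23b : NullCobordism.isHomotopyEquiv_compl_ball_of_contractibleSpace) :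
    isHCobordant_sphere_of_boundsContractible :=
  isHCobordant_sphere_of_boundsContractible_of
    NullCobordism.exists_cobordism_sphere_compl_ball_holds h23b

end Literature.Topology.FourManifolds
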